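import Literature.NumberTheory.EllipticCurves.TateCurve.NumberFieldUniformizationTwisted
import Literature.NumberTheory.EllipticCurves.TateCurve.NumberFieldUniformizationKernelOfReduction
import Literature.NumberTheory.EllipticCurves.IntegralVariableChange
import HarnessLib

/-!
# Tate's TWISTED `v`-adic uniformisation and the kernel of reduction: `Ψ(1 + 𝔪) ⊆ E₁(K̄_v)` at a
# place of multiplicative reduction, split OR non-split (Silverman, *ATAEC* §V.4 with Lemma V.5.2,
# Thm. V.5.3; theorems only)

Topic `Literature/NumberTheory/EllipticCurves/TateCurve`, namespace
`Literature.NumberTheory.EllipticCurves.TateCurve` (LEAD `bsd-wall-utd-p1` g26, crux r205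
stmt-BirchSwinnertonDyer-24737 `TwinAlgMuZeroAtThree`, line `beta-road`, K2 stub readout/LINK at `v ∣ 3`;
sequel to `NumberFieldUniformizationKernelOfReduction` (split case, p762862)).

For an elliptic curve `W` over a number field `K` (`K : Type`) with MULTIPLICATIVE reduction at `v`
(split or non-split) the tree's PROVED twisted uniformisation
(`Silverman1994_thmV53_corV54_tateUniformisation_holds`, abc-iut cell: `q ∈ K_v`, a change of variables
`C` over `K̄_v` with `C • (W ⊗ K̄_v) = E_q ⊗ K̄_v`, the square root `t` of `γ(W) = −c₄/c₆`, and Tate's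
map twisted by the sign `χ(σ) = ±1` of `σ` on `t`) is re-assembled with the REDUCTION CLAUSE of §V.4:
a principal unit `u` (`|u − 1|_v < 1`) is sent into `E₁(K̄_v) = W.localKernelOfReduction v`.
Proof: `|X(u, q)| = |u − 1|⁻² > 1` (`norm_tateX_one_add_of_isAlgebraic`); `C` relates two
`𝒪_{K̄_v}`-integral models with UNIT `c₄` — `E_q ⊗ K̄_v` (`|c₄(E_q)| = |E₄(q)| = 1`) and the base change
of the chosen minimal model at `v` (multiplicative reduction: `v(c₄) = 0`) — so its `u` is a unit
(`c₄' = u⁻⁴ c₄`) and its `r` is integral (Silverman *AEC* VII.1.3(d), tree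
`val_r_le_one_of_isIntegral` over the valued field `(K̄_v, |·|_v)`), and the criterion `|x| > 1` for
`E₁` is unchanged (`VariableChange.one_lt_v_toX_iff`).

* **`exists_twistedTateUniformisation_localKernelOfReduction`** — Lemma V.5.2 (c) + Thm. V.5.3 (the
  clauses `q ≠ 0`, `|q|_v < 1`, `t ≠ 0`, `t² = γ(W)`, `Ψ` surjective, `ker Ψ = q^ℤ`, twisted
  equivariance) WITH the reduction clause `|u − 1|_v < 1 → Ψ u ∈ E₁(K̄_v)`.

Consumer: KS(v) (`localKerOver ≤ strictKer` for `C_v = E[p^∞] ∩ E₁(K̄_v)`) at a NON-split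
multiplicative `v ∣ p`, `p` odd, by restriction to the index-`2` subgroup fixing `t`.
BSD is not proved by any of this.

## References
* [SilvermanATAEC1994] J. H. Silverman, *Advanced Topics in the Arithmetic of Elliptic Curves*,
  GTM 151, Springer 1994, Thm. V.3.1 (c),(d), §V.4, Lemma V.5.2, Thm. V.5.3 (PDF pp. 395–409).
* [SilvermanAEC2009] J. H. Silverman, *The Arithmetic of Elliptic Curves*, 2nd ed., Prop. VII.1.3(d),
  Props. VII.2.1–2.2, VII.5.1 (b).
-/

noncomputable section

open scoped Classical NNReal
open NumberField IsDedekindDomain WeierstrassCurve Field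

namespace Literature.NumberTheory.EllipticCurves.TateCurve

open SteinWuthrich2013 Literature.NumberTheory.EllipticCurves
  Literature.NumberTheory.GaloisRepresentations IsDedekindDomain.HeightOneSpectrum

variable {K : Type} [Field K] [NumberField K] (W : WeierstrassCurve K) [W.IsElliptic]
  (v : HeightOneSpectrum (𝓞 K))

/-- **Silverman ATAEC Lemma V.5.2 (c) + Thm. V.5.3 AND the first line of §V.4, PROVED (split or
non-split multiplicative reduction)**: there are `q ∈ K_v` (`q ≠ 0`, `|q|_v < 1`), a square root
`t ≠ 0` of `γ(W/K) = −c₄/c₆` in `K̄_v`, and a surjective homomorphism `Ψ : K̄_vˣ → E(K̄_v)` with kernel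
`q^ℤ` and the TWISTED equivariance `σ • Ψ(u) = χ(σ) Ψ(σu)` (`χ(σ) = 1` iff `σ t = t`), such that
**every principal unit `u` (`|u − 1|_v < 1`) is sent into the kernel of reduction `E₁(K̄_v)`**.
[cite: SilvermanATAEC1994, Lemma V.5.2 (c), Thm. V.5.3 (PDF pp. 406–409), Thm. V.3.1 (c)(d), §V.4 (PDF p. 399)]
[cite: SilvermanAEC2009, Prop. VII.1.3(d), Props. VII.2.1–2.2] -/
theorem exists_twistedTateUniformisation_localKernelOfReduction
    (hmult : W.HasMultiplicativeReductionAt v) :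
    ∃ (q : v.adicCompletion K) (t : AlgebraicClosure (v.adicCompletion K))
      (Ψ : Additive (AlgebraicClosure (v.adicCompletion K))ˣ →+ localPoints W (v.adicCompletion K)),
      q ≠ 0 ∧ Valued.v q < 1 ∧ t ≠ 0 ∧
      t ^ 2 = algebraMap (v.adicCompletion K) (AlgebraicClosure (v.adicCompletion K))
        (algebraMap K (v.adicCompletion K) (-(W.c₄ / W.c₆))) ∧
      Function.Surjective Ψ ∧
      (∀ u : (AlgebraicClosure (v.adicCompletion K))ˣ, Ψ (Additive.ofMul u) = 0 ↔
        ∃ n : ℤ, (u : AlgebraicClosure (v.adicCompletion K)) =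
          algebraMap (v.adicCompletion K) (AlgebraicClosure (v.adicCompletion K)) q ^ n) ∧
      (∀ (σ : absoluteGaloisGroup (v.adicCompletion K))
          (u : (AlgebraicClosure (v.adicCompletion K))ˣ),
        σ • Ψ (Additive.ofMul u) =
          (if Field.absoluteGaloisGroup.toAlgEquiv (v.adicCompletion K) σ t = t then (1 : ℤ)
            else -1) •
          Ψ (Additive.ofMul (Units.map
            (Field.absoluteGaloisGroup.toAlgEquiv (v.adicCompletion K) σ :
              AlgebraicClosure (v.adicCompletion K) →* AlgebraicClosure (v.adicCompletion K))
            u))) ∧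
      (∀ u : (AlgebraicClosure (v.adicCompletion K))ˣ,
        v.spectralValuation ((u : AlgebraicClosure (v.adicCompletion K)) - 1) < 1 →
        Ψ (Additive.ofMul u) ∈ W.localKernelOfReduction v) := by
  letI := GaloisRepresentations.Ultrametric.AdicCompletion.nontriviallyNormedField K v
  haveI := charZero_adicCompletion' K v
  set L := AlgebraicClosure (v.adicCompletion K) with hL
  -- Step 1: `|j|_v > 1`, `c₄ c₆ ≠ 0`
  have hj := one_lt_norm_j_baseChange_of_hasMultiplicativeReductionAt W v hmult
  obtain ⟨hc₄, hc₆⟩ := c₄_ne_zero_and_c₆_ne_zero_of_hasMultiplicativeReductionAt W v hmult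
  -- Step 2: the Tate parameter and an isomorphism `C` over `K̄_v` (V.5.3 (a))
  obtain ⟨q, hq0, hq, hqj, C, hC⟩ :=
    isomorphic_tateCurve_of_one_lt_norm_j_holds (W.baseChange (v.adicCompletion K)) hj
  obtain ⟨hEc₄, hEc₆⟩ := tateCurve_c₄_ne_zero_and_c₆_ne_zero W v hq0 hq hqj hj
  -- the square root `t` of `γ(W)`
  obtain ⟨t, ht⟩ := IsAlgClosed.exists_pow_nat_eq
    (algebraMap (v.adicCompletion K) (AlgebraicClosure (v.adicCompletion K))
      (algebraMap K (v.adicCompletion K) (-(W.c₄ / W.c₆)))) two_pos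
  have ht0 : t ≠ 0 := by
    intro h
    have ht' := ht
    rw [h, zero_pow two_ne_zero, eq_comm, map_eq_zero, map_eq_zero, neg_eq_zero,
      div_eq_zero_iff] at ht'
    exact ht'.elim hc₄ hc₆
  -- `K̄_v` with the spectral norm, and Tate's EXPLICIT `φ(u) = (X(u,q), Y(u,q))`
  letI : NontriviallyNormedField L :=
    spectralNorm.nontriviallyNormedField (v.adicCompletion K) L
  letI : NormedAlgebra (v.adicCompletion K) L := spectralNorm.normedAlgebra (v.adicCompletion K) L
  haveI : IsUltrametricDist L :=
    IsUltrametricDist.isUltrametricDist_of_isNonarchimedean_norm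
      (isNonarchimedean_spectralNorm (K := v.adicCompletion K) (L := L))
  let φ : Additive Lˣ →+ geomPoints (tateCurve q) :=
    { toFun := fun a => tatePointAlg q (Additive.toMul a)
      map_zero' := tatePointAlg_of_eq_zpow (F := L) (q := q) 1 (n := 0) (by simp)
      map_add' := fun a b => by
        simp only [toMul_add]
        exact tatePointAlg_mul addRelX_eq_zero addRelY_eq_zero hq0 hq _ _ }
  have hφ : ∀ u : Lˣ, φ (Additive.ofMul u) = tatePointAlg q u := fun _ => rfl
  have hsurj : Function.Surjective φ := by
    intro P
    obtain ⟨u, hu⟩ := tatePointAlg_surjective (F := L) addRelX_eq_zero addRelY_eq_zero hq0 hq P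
    exact ⟨Additive.ofMul u, hu⟩
  have hker : ∀ u : Lˣ, φ (Additive.ofMul u) = 0 ↔
      ∃ n : ℤ, (u : L) = algebraMap (v.adicCompletion K) L q ^ n :=
    fun u => tatePointAlg_eq_zero_iff hq0 hq u
  have hequiv : ∀ (σ : absoluteGaloisGroup (v.adicCompletion K)) (u : Lˣ),
      σ • φ (Additive.ofMul u) =
        φ (Additive.ofMul (Units.map
          (absoluteGaloisGroup.toAlgEquiv (v.adicCompletion K) σ : L →* L) u)) := by
    intro σ u
    rw [hφ, hφ]
    exact map_algEquiv_tatePointAlg hq0 hq (absoluteGaloisGroup.toAlgEquiv (v.adicCompletion K) σ) u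
  -- the isomorphism of point groups `e = C`
  obtain ⟨e, he⟩ : ∃ e : localPoints W (v.adicCompletion K) ≃+ geomPoints (tateCurve q),
      ∀ P, e P = Affine.Point.congrEquiv hC (VariableChange.pointEquiv _ C
        (Affine.Point.congrEquiv (W.baseChange_baseChange_adicCompletion v).symm P)) :=
    ⟨(Affine.Point.congrEquiv (W.baseChange_baseChange_adicCompletion v).symm).trans
      ((VariableChange.pointEquiv ((W.baseChange (v.adicCompletion K)).baseChange L) C).trans
        (Affine.Point.congrEquiv hC)), fun _ ↦ rfl⟩
  have hsign := smul_eq_sign_smul W v hc₄ hc₆ hq hEc₄ hEc₆ C hC ht e he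
  -- `Ψ = C⁻¹ ∘ φ`
  refine ⟨q, t, e.symm.toAddMonoidHom.comp φ, hq0, ?_, ht0, ht, ?_, ?_, ?_, ?_⟩
  · exact (Valued.toNormedField.norm_lt_one_iff).mp hq
  · exact e.symm.surjective.comp hsurj
  · intro u
    rw [← hker u]
    change e.symm (φ (Additive.ofMul u)) = 0 ↔ _
    rw [AddEquiv.map_eq_zero_iff]
  · -- twisted equivariance: `σ Ψ(u) = χ(σ) Ψ(σ u)`
    intro σ u
    change σ • e.symm (φ (Additive.ofMul u)) = _ • e.symm (φ _)
    rw [← hequiv σ u]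
    have h1 := hsign σ (e.symm (φ (Additive.ofMul u)))
    rw [AddEquiv.apply_symm_apply] at h1
    apply e.injective
    rw [map_zsmul, AddEquiv.apply_symm_apply, h1, smul_smul]
    split_ifs <;> simp
  · -- §V.4: principal units go to the kernel of reduction
    intro u hu1
    have hw := coe_spectralValuation v
    change e.symm (φ (Additive.ofMul u)) ∈ W.localKernelOfReduction v
    rw [hφ]
    by_cases h1 : (u : L) = 1
    · have h0 : tatePointAlg q u = 0 :=
        tatePointAlg_of_eq_zpow u (n := 0) (by rw [h1, zpow_zero])
      rw [h0]
      change e.symm (0 : geomPoints (tateCurve q)) ∈ W.localKernelOfReduction v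
      rw [map_zero]
      exact AddSubgroup.zero_mem _
    · set s : L := (u : L) - 1 with hs_def
      have hs0 : s ≠ 0 := fun h => h1 (sub_eq_zero.mp h)
      have hnorm : ∀ x : L, ‖x‖ = (v.spectralValuation x : ℝ) := fun x => by rw [hw]; rfl
      have hs : ‖s‖ < 1 := by
        rw [hnorm, ← NNReal.coe_one, NNReal.coe_lt_coe]; exact hu1
      have hus : (u : L) = 1 + s := by rw [hs_def]; ring
      have hunorm : ‖(u : L)‖ = 1 := by rw [hus]; exact norm_one_add_eq_one hs
      have hqL : ‖algebraMap (v.adicCompletion K) L q‖ < 1 := norm_algebraMap_lt_one hq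
      have hqL0 : algebraMap (v.adicCompletion K) L q ≠ 0 := (map_ne_zero _).mpr hq0
      have hu' : ∀ n : ℤ, (u : L) ≠ algebraMap (v.adicCompletion K) L q ^ n := by
        intro n hn
        have hn1 : ‖algebraMap (v.adicCompletion K) L q‖ ^ n = 1 := by
          rw [← norm_zpow, ← hn, hunorm]
        rcases lt_trichotomy n 0 with hneg | rfl | hpos
        · exact absurd hn1 (ne_of_gt (one_lt_zpow_of_neg₀ (norm_pos_iff.mpr hqL0) hqL hneg))
        · exact h1 (by rw [hn, zpow_zero])
        · exact absurd hn1 (ne_of_lt (zpow_lt_one₀ (norm_pos_iff.mpr hqL0) hqL hpos))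
      have hP : tatePointAlg q u = .some _ _ (nonsingular_tate_alg hq0 hq u hu') :=
        tatePointAlg_of_ne_zpow hq0 hq u hu'
      have hX : 1 < ‖tateX (algebraMap (v.adicCompletion K) L q) (u : L)‖ := by
        rw [hus, norm_tateX_one_add_of_isAlgebraic hq hs0 hs]
        have : 1 < ‖s‖⁻¹ := one_lt_inv_iff₀.mpr ⟨norm_pos_iff.mpr hs0, hs⟩
        nlinarith
      have hXw : 1 < v.spectralValuation (tateX (algebraMap (v.adicCompletion K) L q) (u : L)) := by
        rw [← NNReal.coe_lt_coe, NNReal.coe_one, ← hnorm]; exact hX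
      -- the point `P = Ψ u` of `W ⊗ K̄_v` and its coordinates: `C.toX x = X(u, q)`
      set P : localPoints W (v.adicCompletion K) := e.symm (tatePointAlg q u) with hP_def
      have heP : e P = tatePointAlg q u := by rw [hP_def, AddEquiv.apply_symm_apply]
      change (W.baseChange L).toAffine.Point at P
      rcases hPc : P with _ | ⟨x, y, hxy⟩
      · exact AddSubgroup.zero_mem _
      · have hXeq : C.toX x = tateX (algebraMap (v.adicCompletion K) L q) (u : L) := by
          have h2 : e (show localPoints W (v.adicCompletion K) from .some x y hxy) = tatePointAlg q u := by
            rw [← hPc]; exact heP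
          rw [he, Affine.Point.congrEquiv_some, VariableChange.pointEquiv_some,
            Affine.Point.congrEquiv_some, hP] at h2
          exact ((Affine.Point.some.injEq _ _ _ _ _ _).mp h2).1
        -- the chosen minimal model `Cv • W_v` at `v` and `D = (Cv ⊗ K̄_v) C⁻¹`
        set Cv : VariableChange (v.adicCompletion K) :=
          ((W.baseChange (v.adicCompletion K)).exists_isMinimal (v.adicCompletionIntegers K)).choose
          with hCv
        set D : VariableChange L := Cv.map (algebraMap (v.adicCompletion K) L) * C⁻¹ with hD
        -- `V₁ = E_q ⊗ K̄_v`, `V₂ = (Cv • W_v) ⊗ K̄_v = D • V₁`, both `|·|_v`-integral with unit `c₄`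
        have hmin : W.localMinimalModel v = Cv • W.baseChange (v.adicCompletion K) := rfl
        have hV : (W.localMinimalModel v).baseChange L = D • (tateCurve q).baseChange L := by
          rw [hD, mul_smul, ← hC, inv_smul_smul, hmin, WeierstrassCurve.baseChange,
            WeierstrassCurve.baseChange, ← map_variableChange]
          rfl
        have hX2 : (W.localMinimalIntegralModel v).map
            (algebraMap (v.adicCompletionIntegers K) (v.adicCompletion K)) = W.localMinimalModel v :=
          baseChange_integralModel_eq (v.adicCompletionIntegers K) (W.localMinimalModel v)
        haveI hint₂ : ((W.localMinimalModel v).baseChange L).IsIntegral (v.spectralValuation).integer := by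
          rw [← hX2]
          exact isIntegral_spectralValuation_baseChange hw (W.localMinimalIntegralModel v)
        haveI hintq : IsIntegral (v.adicCompletionIntegers K) (tateCurve q) :=
          tateCurve_isIntegral (v.adicCompletionIntegers K)
            (norm_le_one_iff_mem_range_adicCompletionIntegers K v) hq
        have hX1 : ((tateCurve q).integralModel (v.adicCompletionIntegers K)).map
            (algebraMap (v.adicCompletionIntegers K) (v.adicCompletion K)) = tateCurve q :=
          baseChange_integralModel_eq (v.adicCompletionIntegers K) (tateCurve q)
        haveI hint₁ : ((tateCurve q).baseChange L).IsIntegral (v.spectralValuation).integer := by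
          rw [← hX1]
          exact isIntegral_spectralValuation_baseChange hw
            ((tateCurve q).integralModel (v.adicCompletionIntegers K))
        -- `|c₄(V₁)| = |E₄(q)| = 1`, `|c₄(V₂)| = 1` (multiplicative reduction), so `|u_D| = 1`
        have hc₄1 : v.spectralValuation ((tateCurve q).baseChange L).c₄ = 1 := by
          apply NNReal.coe_injective
          rw [WeierstrassCurve.baseChange, map_c₄, coe_spectralValuation_algebraMap hw, tateCurve_c₄,
            norm_tateE4_eq_one hq, NNReal.coe_one]
        have hc₄2 : v.spectralValuation ((W.localMinimalModel v).baseChange L).c₄ = 1 := by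
          apply NNReal.coe_injective
          rw [WeierstrassCurve.baseChange, map_c₄, coe_spectralValuation_algebraMap hw, NNReal.coe_one]
          exact (valuation_eq_one_iff_norm_eq_one (norm_le_one_iff_mem_range_adicCompletionIntegers K v)
            _).mp hmult.multiplicativeReduction
        have huD : v.spectralValuation (D.u : L) = 1 := by
          have h := hc₄2
          rw [hV, variableChange_c₄, map_mul, map_pow, hc₄1, mul_one, Units.val_inv_eq_inv_val,
            map_inv₀, inv_pow, inv_eq_one] at h
          exact (pow_eq_one_iff_of_nonneg zero_le four_ne_zero).mp h
        have hrD : v.spectralValuation D.r ≤ 1 :=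
          val_r_le_one_of_isIntegral (V₁ := (tateCurve q).baseChange L)
            (V₂ := (W.localMinimalModel v).baseChange L) hV huD.le
        -- the criterion `|x| > 1` on the chosen minimal model
        have hQ : W.localPointsEquivModel v (show localPoints W (v.adicCompletion K) from .some x y hxy) =
            .some ((Cv.map (algebraMap (v.adicCompletion K) L)).toX x)
              ((Cv.map (algebraMap (v.adicCompletion K) L)).toY x y) ?_ := by
          rw [localPointsEquivModel_apply, localPointsEquivPoint_apply]
          change Affine.Point.congrEquiv _ (VariableChange.pointEquivBaseChange _ _ _
            (Affine.Point.congrEquiv _ (.some x y hxy))) = _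
          rw [Affine.Point.congrEquiv_some, VariableChange.pointEquivBaseChange_some,
            Affine.Point.congrEquiv_some]
        refine (W.mem_localKernelOfReduction_iff_of_eq_some v hQ).mpr ?_
        have hfac : Cv.map (algebraMap (v.adicCompletion K) L) = D * C := by
          rw [hD, inv_mul_cancel_right]
        rw [hfac, VariableChangeAux.toX_mul, VariableChange.one_lt_v_toX_iff _ huD hrD, hXeq]
        exact hXw

end Literature.NumberTheory.EllipticCurves.TateCurve

end
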